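import Summits.Ventures.CertifiedManyBodySolver.Upper.IntervalReaderQuadKernel
import Summits.Ventures.CertifiedManyBodySolver.Upper.IntervalReaderBoxKernel
import Summits.Ventures.CertifiedManyBodySolver.Upper.IntervalReaderSourcedBoxEnergy

/-!
# Ventures/CertifiedManyBodySolver — Upper/IntervalReaderQuadDGamma.lean: the `l3core-sgf` automaton represents `dΓ(M)`
(part 21 of the Theorem-H1′ package; parts 1–20: `IntervalReaderSchur` … `IntervalReaderQuadKernel`)

HONEST FRAMING: first certified bounds; not a superconductivity verdict; every number certified or labelled
float.  Pure algebra; no number is certified, no row moves; a sourced-Hamiltonian upper is a variational energy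
CEILING for `H − μN − h(Δ + Δ†)`, never a sign of order.

Part 20 identified the `(START, FINAL)` kernel of the `l3core-sgf` automaton `quadAutomaton τ ν V` with the word
sum `quadWordSum τ ν V` on the enumeration order.  The W5 / FORMAT-mpsgf1 Hamiltonian in the transformed frame is
`dΓ(𝓗) − μ·ab·1 + U (N_↑ − Σ n_↑n_↓)` (part 11, `partialParticleHole_conj_dWaveSourceOpenBox`), whose one-body part
`dΓ(𝓗)` runs over ALL orbital pairs — cross-site (both spins, both spin-flips), intra-site, diagonal.  This file
closes the gap between the two vocabularies ON THE ENUMERATION ORDER `Fin N`: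

* `dGammaHop M` / `dGammaOnSite M` — the cross-site weights `τ k s k′ s′ = M (k,s) (k′,s′)` and the on-site words
  `V k = Σ_{s,s′} M (k,s) (k,s′) • c†_s c_{s′}` (diagonal entries = `ε n`, off-diagonal = intra-site hopping) of a
  one-body matrix `M` on `Orb (Fin N)`;
* `toSpin_dGamma_eq_quadWordSum` — for SYMMETRIC `M` (`M i j = M j i`, the `sgf_model` class
  `Σ_{p<q} τ_pq (c†_p c_q + c†_q c_p) + Σ ε_p n_p`):  `toSpin (dGamma M) = quadWordSum (dGammaHop M) 0 (dGammaOnSite M)`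
  (part 11's `toSpin_dGamma_eq_sum_productOp` + `orbWordFamily`, folded onto site pairs `k < k′` / `k = k′`);
* `automatonKernel_quad_eq_toSpin_dGamma` — hence the `l3core-sgf` automaton with these weights REPRESENTS `dΓ(M)`:
  `Matrix.of (K START FINAL) = toSpin (dGamma M)`; additional on-site words (`U (n_↑ − n_↑n_↓)`, `−μ·ab` at one
  site, density–density `ν`) enter `quadWordSum` additively (`quadWordSum_add_onSite`).

* `orbWordFamily_comp_of_strictMono`, `orbPullback`, `inner_toSpin_dGamma_relabel` — transport to the box's own
  vertex type along a MONOTONE enumeration `e` (part 18's condition; E1's / ird-3's column-major order satisfies it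
  by `colMajorEquiv_lt_iff`): `star Ψ ⬝ᵥ (toSpin (dGamma M) *ᵥ Ψ′) = star ψ ⬝ᵥ (toSpin (dGamma (orbPullback e M)) *ᵥ ψ′)`
  for `Ψ = ψ ∘ (· ∘ e)` — so part 11's `Σ 𝓗 i j · S(word_ij ∘ e)` term IS the `l3core-sgf` automaton's `H`-number
  target with `M = orbPullback e 𝓗` (symmetric when `𝓗` is).
-/

noncomputable section

open Matrix Finset
open scoped BigOperators ComplexOrder

namespace Summit.Ventures.CertifiedManyBodySolver.Upper.IntervalReader

open Literature.MathematicalPhysics.QuantumLattice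
open Literature.MathematicalPhysics.QuantumLattice.JordanWigner

section DGamma

variable {N : ℕ}

/-- The cross-site hopping weights of a one-body matrix on the enumeration order. -/
def dGammaHop (M : Matrix (Orb (Fin N)) (Orb (Fin N)) ℂ) : Fin N → Fin 2 → Fin N → Fin 2 → ℂ :=
  fun k s k' s' => M (orb k s) (orb k' s')

/-- The on-site words of a one-body matrix: `V k = Σ_{s,s′} M (k,s) (k,s′) • c†_s c_{s′}`. -/
def dGammaOnSite (M : Matrix (Orb (Fin N)) (Orb (Fin N)) ℂ) : Fin N → Matrix (Fin 4) (Fin 4) ℂ :=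
  fun k => ∑ s : Fin 2, ∑ s' : Fin 2, M (orb k s) (orb k s') • (siteCreation s * siteAnnihilation s')

/-- A double sum over sites folds onto the diagonal and the pairs `x < y`. -/
theorem sum_sum_eq_diag_add_lt {E : Type*} [AddCommMonoid E] (f : Fin N → Fin N → E) :
    ∑ x, ∑ y, f x y = ∑ x, f x x + ∑ x, ∑ y, if x < y then f x y + f y x else 0 := by
  have h := sum_sum_eq_sum_sum_lt (fun x y => if x = y then 0 else f x y) (fun x => if_pos rfl)
  have hsplit : ∀ x, ∑ y, f x y = f x x + ∑ y, if x = y then 0 else f x y := by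
    intro x
    rw [← Finset.add_sum_erase Finset.univ _ (Finset.mem_univ x)]
    congr 1
    rw [← Finset.add_sum_erase Finset.univ (fun y => if x = y then 0 else f x y) (Finset.mem_univ x), if_pos rfl,
      zero_add]
    exact Finset.sum_congr rfl fun y hy => by rw [if_neg (Finset.ne_of_mem_erase hy).symm]
  calc ∑ x, ∑ y, f x y = ∑ x, (f x x + ∑ y, if x = y then 0 else f x y) := Finset.sum_congr rfl fun x _ => hsplit x
    _ = ∑ x, f x x + ∑ x, ∑ y, (if x = y then 0 else f x y) := Finset.sum_add_distrib
    _ = ∑ x, f x x + ∑ x, ∑ y, if x < y then f x y + f y x else 0 := by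
        rw [h]
        congr 1
        refine Finset.sum_congr rfl fun x _ => Finset.sum_congr rfl fun y _ => ?_
        by_cases hxy : x < y
        · rw [if_pos hxy, if_pos hxy, if_neg (ne_of_lt hxy), if_neg (ne_of_gt hxy)]
        · rw [if_neg hxy, if_neg hxy]

/-- Sums over the orbitals of the enumeration order are sums over sites and spins. -/
theorem sum_orb_eq_sum_sum {E : Type*} [AddCommMonoid E] (g : Orb (Fin N) → E) :
    ∑ i, g i = ∑ k : Fin N, ∑ s : Fin 2, g (orb k s) := by
  rw [← Fintype.sum_prod_type']
  exact (Fintype.sum_equiv toLex (fun p : Fin N × Fin 2 => g (orb p.1 p.2)) g fun p => rfl).symm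

/-- **`dΓ(M)` is the word sum of the `l3core-sgf` automaton** (symmetric `M`). -/
theorem toSpin_dGamma_eq_quadWordSum (M : Matrix (Orb (Fin N)) (Orb (Fin N)) ℂ) (hM : ∀ i j, M i j = M j i) :
    toSpin (dGamma M) = quadWordSum (dGammaHop M) (fun _ _ _ _ => 0) (dGammaOnSite M) := by
  rw [toSpin_dGamma_eq_sum_productOp, quadWordSum, sum_orb_eq_sum_sum]
  simp only [sum_orb_eq_sum_sum (fun j => M _ j • productOp (orbWordFamily _ (ofLex j).1 _ (ofLex j).2))]
  -- now: Σ_k Σ_s Σ_k' Σ_s' M (orb k s) (orb k' s') • productOp (orbWordFamily k k' s s')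
  have hproj : ∀ (k : Fin N) (s : Fin 2), (ofLex (orb k s)).1 = k ∧ (ofLex (orb k s)).2 = s := fun k s => ⟨rfl, rfl⟩
  simp only [hproj]
  -- bring the site sums together and fold onto `k = k′` / `k < k′`
  rw [Finset.sum_congr rfl fun k _ => Finset.sum_comm (f := fun s k' => ∑ s' : Fin 2,
    M (orb k s) (orb k' s') • productOp (orbWordFamily k k' s s')),
    sum_sum_eq_diag_add_lt (fun k k' => ∑ s : Fin 2, ∑ s' : Fin 2,
      M (orb k s) (orb k' s') • productOp (orbWordFamily k k' s s'))]
  congr 1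
  · -- diagonal: the on-site words
    refine Finset.sum_congr rfl fun k _ => ?_
    simp only [orbWordFamily, if_true, dGammaOnSite, ← onSite_eq_productOp, Fin.sum_univ_two, onSite_add',
      onSite_smul']
  · -- site pairs `k < k′`: the two hopping words, symmetric weights
    refine Finset.sum_congr rfl fun k _ => Finset.sum_congr rfl fun k' _ => ?_
    by_cases hkk' : k < k'
    · have hne : k ≠ k' := ne_of_lt hkk'
      have hne' : k' ≠ k := ne_of_gt hkk'
      simp only [hkk', if_true, orbWordFamily, hne, hne', if_false, dGammaHop, zero_smul, add_zero, smul_add,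
        Finset.sum_add_distrib]
      congr 1
      rw [Finset.sum_comm]
      exact Finset.sum_congr rfl fun s' _ => Finset.sum_congr rfl fun s _ => by rw [hM]
    · simp [hkk']

/-- Word sums are additive in the on-site words. -/
theorem quadWordSum_add_onSite (τ ν : Fin N → Fin 2 → Fin N → Fin 2 → ℂ) (V V' : Fin N → Matrix (Fin 4) (Fin 4) ℂ) :
    quadWordSum τ ν (fun k => V k + V' k) = quadWordSum τ ν V + ∑ k, onSite k (V' k) := by
  simp only [quadWordSum, onSite_add', Finset.sum_add_distrib]
  abel

/-- **The `l3core-sgf` automaton represents `dΓ(M)`** (symmetric one-body matrix on the enumeration order, no extra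
on-site or density words): `Matrix.of (K START FINAL) = toSpin (dGamma M)`. -/
theorem automatonKernel_quad_eq_toSpin_dGamma (M : Matrix (Orb (Fin N)) (Orb (Fin N)) ℂ) (hM : ∀ i j, M i j = M j i) :
    (Matrix.of fun ξ η : TensorIndex (Fin N) 4 =>
        automatonKernel N (quadAutomaton (dGammaHop M) (fun _ _ _ _ => 0) (dGammaOnSite M)) ξ η
          QState.start QState.fin) = toSpin (dGamma M) := by
  ext ξ η
  rw [Matrix.of_apply, automatonKernel_quad_start_fin, toSpin_dGamma_eq_quadWordSum M hM, quadWordSum]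

end DGamma

/-! ## §LL  Transport along a monotone enumeration -/

section Relabel

variable {Λ : Type*} [LinearOrder Λ] [Fintype Λ] {N : ℕ}

omit [Fintype Λ] in
/-- **One-body words relabel along a monotone enumeration** (on-site words along any bijection, hopping words by
part 18's `hopFamily_comp_of_strictMono`). -/
theorem orbWordFamily_comp_of_strictMono (e : Fin N ≃ Λ) (he : ∀ i j, e i < e j ↔ i < j) (k k' : Fin N)
    (s s' : Fin 2) : (fun i => orbWordFamily (e k) (e k') s s' (e i)) = orbWordFamily k k' s s' := by
  by_cases h : k = k'
  · subst h
    have h1 : (fun i => orbWordFamily (e k) (e k) s s' (e i)) = fun i =>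
        Function.update (fun _ => (1 : Matrix (Fin 4) (Fin 4) ℂ)) (e k) (siteCreation s * siteAnnihilation s') (e i) := by
      funext i
      rw [orbWordFamily, if_pos rfl]
    rw [h1, update_comp_equiv, orbWordFamily, if_pos rfl]
  · have hne : e k ≠ e k' := fun h' => h (e.injective h')
    have h1 : (fun i => orbWordFamily (e k) (e k') s s' (e i)) = fun i => hopFamily (e k) (e k') s s' (e i) := by
      funext i
      rw [orbWordFamily, if_neg hne]
    rw [h1, hopFamily_comp_of_strictMono e he, orbWordFamily, if_neg h]

/-- The orbitals of the chain read as orbitals of the box along `e`. -/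
def orbEquiv (e : Fin N ≃ Λ) : Orb (Fin N) ≃ Orb Λ :=
  toLex.symm.trans ((e.prodCongr (Equiv.refl (Fin 2))).trans toLex)

omit [LinearOrder Λ] [Fintype Λ] in
/-- `orbEquiv e (k, s) = (e k, s)`. -/
theorem orbEquiv_orb (e : Fin N ≃ Λ) (k : Fin N) (s : Fin 2) : orbEquiv e (orb k s) = orb (e k) s := rfl

/-- The one-body matrix pulled back to the chain's orbitals: `(orbPullback e M) (k,s) (k′,s′) = M (e k, s) (e k′, s′)`. -/
def orbPullback (e : Fin N ≃ Λ) (M : Matrix (Orb Λ) (Orb Λ) ℂ) : Matrix (Orb (Fin N)) (Orb (Fin N)) ℂ :=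
  fun i j => M (orbEquiv e i) (orbEquiv e j)

omit [LinearOrder Λ] [Fintype Λ] in
/-- A symmetric matrix pulls back to a symmetric matrix. -/
theorem orbPullback_symm (e : Fin N ≃ Λ) (M : Matrix (Orb Λ) (Orb Λ) ℂ) (hM : ∀ i j, M i j = M j i)
    (i j : Orb (Fin N)) : orbPullback e M i j = orbPullback e M j i := hM _ _

/-- **`dΓ` commutes with monotone relabelling** (pairing form): for a monotone enumeration `e`, any one-body
matrix `M` on `Orb Λ`, and chain vectors `ψ, ψ′` read on the box as `Ψ k = ψ (k ∘ e)`,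
`star Ψ ⬝ᵥ (toSpin (dGamma M) *ᵥ Ψ′) = star ψ ⬝ᵥ (toSpin (dGamma (orbPullback e M)) *ᵥ ψ′)`. -/
theorem inner_toSpin_dGamma_relabel (e : Fin N ≃ Λ) (he : ∀ i j, e i < e j ↔ i < j)
    (M : Matrix (Orb Λ) (Orb Λ) ℂ) (ψ ψ' : TensorIndex (Fin N) 4 → ℂ) :
    star (fun k : TensorIndex Λ 4 => ψ (fun i => k (e i))) ⬝ᵥ
        (toSpin (dGamma M) *ᵥ fun k : TensorIndex Λ 4 => ψ' (fun i => k (e i))) =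
      star ψ ⬝ᵥ (toSpin (dGamma (orbPullback e M)) *ᵥ ψ') := by
  rw [toSpin_dGamma_eq_sum_productOp, toSpin_dGamma_eq_sum_productOp]
  simp only [Matrix.sum_mulVec, dotProduct_sum, smul_mulVec, dotProduct_smul]
  -- reindex the box orbitals along `orbEquiv e`
  rw [← Fintype.sum_equiv (orbEquiv e) (fun i => ∑ j : Orb Λ, M (orbEquiv e i) j •
      (star (fun k : TensorIndex Λ 4 => ψ (fun i => k (e i))) ⬝ᵥ
        (productOp (orbWordFamily (ofLex (orbEquiv e i)).1 (ofLex j).1 (ofLex (orbEquiv e i)).2 (ofLex j).2) *ᵥ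
          fun k : TensorIndex Λ 4 => ψ' (fun i => k (e i))))) _ (fun _ => rfl)]
  refine Finset.sum_congr rfl fun i _ => ?_
  rw [← Fintype.sum_equiv (orbEquiv e) (fun j => M (orbEquiv e i) (orbEquiv e j) •
      (star (fun k : TensorIndex Λ 4 => ψ (fun i => k (e i))) ⬝ᵥ
        (productOp (orbWordFamily (ofLex (orbEquiv e i)).1 (ofLex (orbEquiv e j)).1 (ofLex (orbEquiv e i)).2
            (ofLex (orbEquiv e j)).2) *ᵥ
          fun k : TensorIndex Λ 4 => ψ' (fun i => k (e i))))) _ (fun _ => rfl)]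
  refine Finset.sum_congr rfl fun j _ => ?_
  -- `i = (k, s)`, `j = (k′, s′)` on the chain; the box word read at the enumerated sites is the chain word
  have hi : (ofLex (orbEquiv e i)).1 = e (ofLex i).1 ∧ (ofLex (orbEquiv e i)).2 = (ofLex i).2 := ⟨rfl, rfl⟩
  have hj : (ofLex (orbEquiv e j)).1 = e (ofLex j).1 ∧ (ofLex (orbEquiv e j)).2 = (ofLex j).2 := ⟨rfl, rfl⟩
  rw [hi.1, hi.2, hj.1, hj.2, inner_productOp_compEquiv, orbWordFamily_comp_of_strictMono e he]
  rfl

end Relabel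

end Summit.Ventures.CertifiedManyBodySolver.Upper.IntervalReader

end
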